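import Mathlib
import Literature.MathematicalPhysics.QuantumFieldTheory.MagnenRivasseauSeneor1993.MRS93OneLoopFiniteTerms
import Literature.MathematicalPhysics.QuantumFieldTheory.MagnenRivasseauSeneor1993.MRS93OneLoopMassCounterterm
import HarnessLib

/-!
# Magnen–Rivasseau–Sénéor, *Construction of YM₄ with an infrared cutoff* (CMP 155, 1993), Lemma III.1 p.348 — BOTH printed
# sentences, «a_ρ ≅ aλ_ρ⁴, b_ρ ≅ bM^{2ρ}λ_ρ², c_ρ ≅ cλ_ρ², d_ρ ≅ dλ_ρ², e_ρ ≅ eλ_ρ⁴ (III.2)» and «by choosing the cutoff of the form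
# (II.14) with η small enough … the coefficient a is strictly positive», for the ONE-LOOP counterterm family of §III pp.348–352

elementary bookkeeping on top of this seat's files 53 `MRS93OneLoopFiniteTerms` (the one-loop `A⁴/24` integral (III.4) for the cutoff
(II.14): finite terms bounded, `a(η) > 0` and «as large as we want», independence of the cutoff index `ρ`) and 54
`MRS93OneLoopMassCounterterm` (the one-loop `A²` integral: negative, exactly `∝ M^{2ρ}`); nothing continuum, nothing about Bałaban's
programme (cell pub-balaban-gaps, track G3), seat mrs-lit-2 (gen 19, file 55); companion record
`run/shared/lean/pub/pub-balaban-gaps/g3/MRS-AS-PRINTED-estimates.md`.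
**EDITION v1.1 (same seat, gen 20; DOCSTRINGS ONLY — every declaration of v1 byte-identical, no import change):** the footnote
marker «⁵» of Lemma III.1's second sentence (p.348 tl.8) is restored in the quotation, and the locator of the A² sign sentence is given in
text-layer lines (p.350 tl.36–37 – p.351 tl.2–4) — the cell referee's R8 nits (gen 60). Nothing else moves.

**Source, verbatim.** p.347 [PDF 23] tl.41 – p.348 [PDF 24] tl.8 (page image `renders-cmp155/p24_full_s6.png`): «For the marginal
counterterms, an analysis to lowest order in perturbation theory is in fact enough for our purpose (because of asymptotic freedom,
further orders again should give no contributions to finite scales in the limit ρ → ∞). We obtain: **Lemma III.1.** a_ρ ≅ aλ_ρ⁴,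
b_ρ ≅ bM^{2ρ}λ_ρ², c_ρ ≅ cλ_ρ², d_ρ ≅ dλ_ρ², e_ρ ≅ eλ_ρ⁴. (III.2) Furthermore by choosing the cutoff of the form (II.14) with η small
enough (depending on the shape of τ), the coefficient a is strictly positive⁵.» (footnote 5, p.348 tl.36–39: «It is not clear whether a
cutoff for which a would be negative (or zero) is strictly forbidden for a constructive analysis. …»; the marker was dropped in v1 and
is restored by EDITION v1.1). The printed proof (pp.348–352) computes, with the
Feynman rules (III.3) and the graphs of Figs. III.2–III.3, the one-loop `A⁴` total «= 0·ρ + finite terms (III.4)» (the `d⁴p/p⁴`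
integral does not see the scale `M^ρ` of the cutoff `κ_ρ(p) = κ(pM^{−ρ})`, (II.13)) with the `|ln η|` of (III.6)–(III.7) making `a`
positive and large, and the one-loop `A²` total «= −2 times the loop integration … [it] diverges as ρ → ∞ and requires a
counterterm … However this A² counterterm is positive (since the contribution is negative, see the −2 above)» (p.350 tl.36–37 –
p.351 tl.2–4; text-layer lines, the running heads being line 1); the other coefficients: «We concentrate on the computation of the
A⁴ counterterms, which is the most interesting, and include also the computation of the A² counterterm. The other ones are less
interesting and left to the reader» (p.348 tl.21–23); «At one loop, which also means at order λ⁴ in perturbation theory» (p.348 tl.24).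

**What is PROVED here (kernel-checked, 0 sorry), for the one-loop family `oneLoopFamily`** — this seat's file 3 datum
`Counterterms.CountertermFamily` whose `a_ρ := λ_ρ⁴ · ∫ d⁴p/p⁴ bracket(κ_ρ(p))` and `b_ρ := λ_ρ² · ∫ d⁴p/p² bracket2(κ_ρ(p))` are the
PRINTED one-loop integrals of files 53 / 54 written with mrs-lit-1's scaled cutoff `Ansatz.scaledCutoff P η M ρ` of (II.13)–(II.14),
and whose `c_ρ, d_ρ, e_ρ` are ARBITRARY given sequences:
* §1 `oneLoopFamily_a_div` / `oneLoopFamily_b_div`: `a_ρ/λ_ρ⁴ = oneLoopA4Integral P η t` and `b_ρ/(M^{2ρ}λ_ρ²) = oneLoopA2Integral P η t`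
  for EVERY `ρ` — the ratios of (III.2) are CONSTANT in `ρ` (files 53 / 54: `oneLoopA4Integral_scaledCutoff`,
  `oneLoopA2Integral_scaledCutoff`).
* §2 **`lemmaIII1Scaling_oneLoop`**: file 3's AS-PRINTED predicate `Counterterms.LemmaIII1ScalingPrinted (oneLoopFamily …) M` HOLDS,
  for every profile `τ`, every `η`, every gauge value `t`, every `M > 0`, every nowhere-vanishing bare coupling sequence `λ_ρ`, PROVIDED
  the given `c_ρ, d_ρ, e_ρ` have the printed form (`c_ρ/λ_ρ² → c`, `d_ρ/λ_ρ² → d`, `e_ρ/λ_ρ⁴ → e` — hypotheses, «left to the reader» in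
  print (p.348 tl.23) and NOT computed here); the limits `a`, `b` of (III.2) are IDENTIFIED: `a = oneLoopA4Integral P η t`
  (`tendsto_a_ratio_oneLoop`), `b = oneLoopA2Integral P η t` (`tendsto_b_ratio_oneLoop`).
* §3 **`lemmaIII1_oneLoop`**: the CONJUNCTION of Lemma III.1's two sentences for the one-loop family — (III.2) as above AND file 3's
  `Counterterms.LemmaIII1PositivityPrinted` for the identified limit `η ↦ a(η) = oneLoopA4Integral P η t` (file 53
  `lemmaIII1Positivity_oneLoopA4Integral`: `∃ η₀ > 0, ∀ η ∈ (0, η₀], a(η) > 0`, threshold uniform in `τ`); with the SIGNS of record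
  `sign_b_oneLoop` (`b ≤ −2π² < 0` for every `ζ > 0`, file 54 — «this A² counterterm is positive») and `a_pos_oneLoop`.

**Modelling choices / readings.** (i) «≅» of (III.2) is file 3's reading (i): convergence of the ratios as `ρ → ∞`; for the one-loop
integrals the ratios are in fact constant. (ii) The graph totals `36 + 18t + 7.5t²`, … and `−G′₁ − κG′₂ − κG′₃` are the tree's typed
inputs (`MRS93OneLoopCounterterms`); the Feynman rules are not formalised; the overall constants the paper drops («we always forget to
write the overall multiplication factor (of 2π)», p.348 tl.16–18) are dropped here too — they change neither predicate. (iii) The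
powers `λ_ρ⁴` / `λ_ρ²` are those printed in (III.2) (one-loop four-point / two-point graphs). (iv) `c_ρ, d_ρ, e_ρ` are parameters with
hypotheses of the printed shape — this file does not compute them. (v) `λ` is a Lean keyword: the bare coupling is `lamB`.

**What is NOT claimed.** That the one-loop family IS MRS's counterterm family `CT_ρ` (that «lowest order … is in fact enough» is the
expansion's claim, Sects. IV–V, not formalised); the values of `c, d, e`; the fine tuning of `b_ρ` (a fixed-point problem «as in [R]»,
p.347 — census E7); anything of Sects. IV–VIII, or of Bałaban's papers. MRS work at FIXED INFRARED CUTOFF in finite volume: nothing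
here bears on infinite volume, the continuum limit on `T⁴` as a whole, or a mass gap.
-/

noncomputable section

open Real MeasureTheory Filter Topology

namespace Literature.MathematicalPhysics.QuantumFieldTheory.MagnenRivasseauSeneor1993

namespace LemmaIII1OneLoop

open Ansatz OneLoop Counterterms OneLoopFiniteTerms OneLoopMassCounterterm

variable (P : CutoffProfile) (η M t : ℝ) (lamB c d e : ℕ → ℝ)

/-! ## §1 The one-loop counterterm family and the ratios of (III.2) -/

/-- **The one-loop counterterm family of §III** as a `Counterterms.CountertermFamily` (file 3's (III.1) datum): bare couplings `λ_ρ`,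
`a_ρ := λ_ρ⁴ · ∫ d⁴p/p⁴ bracket_t(κ_ρ(p))` (the one-loop `A⁴/24` total (III.4) with the scaled cutoff `κ_ρ(p) = κ(pM^{−ρ})` of
(II.13)–(II.14)), `b_ρ := λ_ρ² · ∫ d⁴p/p² bracket2_t(κ_ρ(p))` (the one-loop `A²` total of p.350), and given sequences `c_ρ, d_ρ, e_ρ`
(«the other ones are less interesting and left to the reader», p.348 tl.23 — parameters here). [cite: MagnenRivasseauSeneor1993, §III (III.1) p.347, Lemma III.1 (III.2) p.348, (III.4) p.351, p.350 tl.17–37] -/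
def oneLoopFamily : CountertermFamily where
  lamB := lamB
  a := fun ρ => lamB ρ ^ 4 * ∫ p : EuclideanSpace ℝ (Fin 4), bracket t (scaledCutoff P η M ρ ‖p‖) / ‖p‖ ^ 4
  b := fun ρ => lamB ρ ^ 2 * ∫ p : EuclideanSpace ℝ (Fin 4), bracket2 t (scaledCutoff P η M ρ ‖p‖) / ‖p‖ ^ 2
  c := c
  d := d
  e := e

/-- unfolding: the bare couplings of the one-loop family. [cite: MagnenRivasseauSeneor1993, §III (III.1) p.347, (II.11) p.330] -/
@[simp] theorem oneLoopFamily_lamB (ρ : ℕ) : (oneLoopFamily P η M t lamB c d e).lamB ρ = lamB ρ := rfl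

/-- unfolding: `c_ρ` is the given sequence. [cite: MagnenRivasseauSeneor1993, §III (III.1) p.347, p.348 tl.23] -/
@[simp] theorem oneLoopFamily_c : (oneLoopFamily P η M t lamB c d e).c = c := rfl

/-- unfolding: `d_ρ` is the given sequence. [cite: MagnenRivasseauSeneor1993, §III (III.1) p.347, p.348 tl.23] -/
@[simp] theorem oneLoopFamily_d : (oneLoopFamily P η M t lamB c d e).d = d := rfl

/-- unfolding: `e_ρ` is the given sequence. [cite: MagnenRivasseauSeneor1993, §III (III.1) p.347, p.348 tl.23] -/
@[simp] theorem oneLoopFamily_e : (oneLoopFamily P η M t lamB c d e).e = e := rfl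

/-- unfolding: `a_ρ = λ_ρ⁴ · ∫ d⁴p/p⁴ bracket_t(κ_ρ(p))`, the one-loop `A⁴/24` total (III.4) with the scaled cutoff (II.13).
[cite: MagnenRivasseauSeneor1993, §III (III.4) p.351, p.348 tl.24] -/
theorem oneLoopFamily_a (ρ : ℕ) : (oneLoopFamily P η M t lamB c d e).a ρ
    = lamB ρ ^ 4 * ∫ p : EuclideanSpace ℝ (Fin 4), bracket t (scaledCutoff P η M ρ ‖p‖) / ‖p‖ ^ 4 := rfl

/-- unfolding: `b_ρ = λ_ρ² · ∫ d⁴p/p² bracket2_t(κ_ρ(p))`, the one-loop `A²` total of p.350 with the scaled cutoff (II.13).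
[cite: MagnenRivasseauSeneor1993, §III p.350 tl.17–37] -/
theorem oneLoopFamily_b (ρ : ℕ) : (oneLoopFamily P η M t lamB c d e).b ρ
    = lamB ρ ^ 2 * ∫ p : EuclideanSpace ℝ (Fin 4), bracket2 t (scaledCutoff P η M ρ ‖p‖) / ‖p‖ ^ 2 := rfl

variable {M lamB}

/-- **«= 0·ρ + finite terms» (III.4): `a_ρ = λ_ρ⁴ · a` with `a = oneLoopA4Integral P η t` INDEPENDENT of `ρ`** (file 53
`oneLoopA4Integral_scaledCutoff`: `d⁴p/p⁴` does not see the scale `M^ρ`). [cite: MagnenRivasseauSeneor1993, (III.4) p.351, Lemma III.1 (III.2) p.348] -/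
theorem oneLoopFamily_a_eq (hM : 0 < M) (ρ : ℕ) :
    (oneLoopFamily P η M t lamB c d e).a ρ = lamB ρ ^ 4 * oneLoopA4Integral P η t := by
  rw [oneLoopFamily_a, oneLoopA4Integral_scaledCutoff P t hM ρ]

/-- **«b M^{2ρ}» of (III.2): `b_ρ = λ_ρ² · M^{2ρ} · b` with `b = oneLoopA2Integral P η t` INDEPENDENT of `ρ`** (file 54
`oneLoopA2Integral_scaledCutoff`: `d⁴p/p²` is homogeneous of degree 2). [cite: MagnenRivasseauSeneor1993, Lemma III.1 (III.2) p.348, p.350 tl.36 – p.351 tl.4] -/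
theorem oneLoopFamily_b_eq (hM : 0 < M) (ρ : ℕ) :
    (oneLoopFamily P η M t lamB c d e).b ρ = lamB ρ ^ 2 * (M ^ (2 * ρ) * oneLoopA2Integral P η t) := by
  rw [oneLoopFamily_b, oneLoopA2Integral_scaledCutoff P t hM ρ]

/-- The ratio `a_ρ/λ_ρ⁴` of (III.2) is the CONSTANT `oneLoopA4Integral P η t`. [cite: MagnenRivasseauSeneor1993, Lemma III.1 (III.2) p.348] -/
theorem oneLoopFamily_a_div (hM : 0 < M) (hlam : ∀ ρ, lamB ρ ≠ 0) (ρ : ℕ) :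
    (oneLoopFamily P η M t lamB c d e).a ρ / (oneLoopFamily P η M t lamB c d e).lamB ρ ^ 4 = oneLoopA4Integral P η t := by
  rw [oneLoopFamily_a_eq P η t c d e hM ρ, oneLoopFamily_lamB]
  exact mul_div_cancel_left₀ _ (pow_ne_zero _ (hlam ρ))

/-- The ratio `b_ρ/(M^{2ρ}λ_ρ²)` of (III.2) is the CONSTANT `oneLoopA2Integral P η t`. [cite: MagnenRivasseauSeneor1993, Lemma III.1 (III.2) p.348] -/
theorem oneLoopFamily_b_div (hM : 0 < M) (hlam : ∀ ρ, lamB ρ ≠ 0) (ρ : ℕ) :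
    (oneLoopFamily P η M t lamB c d e).b ρ / (M ^ (2 * ρ) * (oneLoopFamily P η M t lamB c d e).lamB ρ ^ 2)
      = oneLoopA2Integral P η t := by
  rw [oneLoopFamily_b_eq P η t c d e hM ρ, oneLoopFamily_lamB,
    show lamB ρ ^ 2 * (M ^ (2 * ρ) * oneLoopA2Integral P η t) = (M ^ (2 * ρ) * lamB ρ ^ 2) * oneLoopA2Integral P η t by ring]
  exact mul_div_cancel_left₀ _ (mul_ne_zero (pow_ne_zero _ hM.ne') (pow_ne_zero _ (hlam ρ)))

/-- `a_ρ/λ_ρ⁴ → a := oneLoopA4Integral P η t` (a constant sequence). [cite: MagnenRivasseauSeneor1993, Lemma III.1 (III.2) p.348] -/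
theorem tendsto_a_ratio_oneLoop (hM : 0 < M) (hlam : ∀ ρ, lamB ρ ≠ 0) :
    Tendsto (fun ρ : ℕ => (oneLoopFamily P η M t lamB c d e).a ρ / (oneLoopFamily P η M t lamB c d e).lamB ρ ^ 4)
      atTop (𝓝 (oneLoopA4Integral P η t)) := by
  have h : (fun ρ : ℕ => (oneLoopFamily P η M t lamB c d e).a ρ / (oneLoopFamily P η M t lamB c d e).lamB ρ ^ 4)
      = fun _ => oneLoopA4Integral P η t := funext fun ρ => oneLoopFamily_a_div P η t c d e hM hlam ρ
  rw [h]
  exact tendsto_const_nhds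

/-- `b_ρ/(M^{2ρ}λ_ρ²) → b := oneLoopA2Integral P η t` (a constant sequence). [cite: MagnenRivasseauSeneor1993, Lemma III.1 (III.2) p.348] -/
theorem tendsto_b_ratio_oneLoop (hM : 0 < M) (hlam : ∀ ρ, lamB ρ ≠ 0) :
    Tendsto (fun ρ : ℕ => (oneLoopFamily P η M t lamB c d e).b ρ
        / (M ^ (2 * ρ) * (oneLoopFamily P η M t lamB c d e).lamB ρ ^ 2)) atTop (𝓝 (oneLoopA2Integral P η t)) := by
  have h : (fun ρ : ℕ => (oneLoopFamily P η M t lamB c d e).b ρ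
      / (M ^ (2 * ρ) * (oneLoopFamily P η M t lamB c d e).lamB ρ ^ 2)) = fun _ => oneLoopA2Integral P η t :=
    funext fun ρ => oneLoopFamily_b_div P η t c d e hM hlam ρ
  rw [h]
  exact tendsto_const_nhds

/-! ## §2 Lemma III.1, display (III.2), for the one-loop family -/

/-- **Lemma III.1 (III.2) for the one-loop counterterm family**: file 3's AS-PRINTED predicate
`Counterterms.LemmaIII1ScalingPrinted (oneLoopFamily …) M` holds — «a_ρ ≅ aλ_ρ⁴, b_ρ ≅ bM^{2ρ}λ_ρ²» with `a = oneLoopA4Integral P η t`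
and `b = oneLoopA2Integral P η t` by §1, «c_ρ ≅ cλ_ρ², d_ρ ≅ dλ_ρ², e_ρ ≅ eλ_ρ⁴» being the printed-form HYPOTHESES on the given
`c_ρ, d_ρ, e_ρ` («left to the reader», p.348 tl.23 — not computed here) — for every profile `τ`, every `η`, every gauge
value `t`, every `M > 0` and every nowhere-vanishing bare coupling sequence. [cite: MagnenRivasseauSeneor1993, §III Lemma III.1 (III.2) p.348 and tl.21–24; (III.4) p.351; p.350 tl.36 – p.351 tl.4] -/
theorem lemmaIII1Scaling_oneLoop (hM : 0 < M) (hlam : ∀ ρ, lamB ρ ≠ 0)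
    (hc : ∃ c₀ : ℝ, Tendsto (fun ρ : ℕ => c ρ / lamB ρ ^ 2) atTop (𝓝 c₀))
    (hd : ∃ d₀ : ℝ, Tendsto (fun ρ : ℕ => d ρ / lamB ρ ^ 2) atTop (𝓝 d₀))
    (he : ∃ e₀ : ℝ, Tendsto (fun ρ : ℕ => e ρ / lamB ρ ^ 4) atTop (𝓝 e₀)) :
    LemmaIII1ScalingPrinted (oneLoopFamily P η M t lamB c d e) M := by
  obtain ⟨c₀, hc⟩ := hc
  obtain ⟨d₀, hd⟩ := hd
  obtain ⟨e₀, he⟩ := he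
  exact ⟨oneLoopA4Integral P η t, oneLoopA2Integral P η t, c₀, d₀, e₀,
    tendsto_a_ratio_oneLoop P η t c d e hM hlam, tendsto_b_ratio_oneLoop P η t c d e hM hlam,
    by simpa using hc, by simpa using hd, by simpa using he⟩

/-! ## §3 Lemma III.1, both sentences, for the one-loop family — with the signs of record -/

/-- **The sign of `b`: «this A² counterterm is positive (since the contribution is negative, see the −2 above)»** — the identified
limit `b = oneLoopA2Integral P η t ≤ −2π² < 0` for every profile `τ`, every `η > 0` and every gauge parameter `ζ > 0`
(`t = 1/ζ − 1 ≥ −8/3`, file 54 `oneLoopA2Integral_le`). [cite: MagnenRivasseauSeneor1993, §III p.350 tl.36 – p.351 tl.4] -/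
theorem sign_b_oneLoop {η t : ℝ} (hη : 0 < η) (ht : -(8 / 3) ≤ t) : oneLoopA2Integral P η t < 0 := by
  have h := oneLoopA2Integral_le P t hη ht
  have hπ : (0 : ℝ) < 2 * π ^ 2 := by positivity
  linarith

/-- **The sign of `a`: «by choosing the cutoff of the form (II.14) with η small enough … the coefficient a is strictly positive»** —
file 3's predicate `LemmaIII1PositivityPrinted` for the identified limit `η ↦ a(η) = oneLoopA4Integral P η t` (file 53; threshold
uniform in the profile `τ`). [cite: MagnenRivasseauSeneor1993, §III Lemma III.1 p.348 tl.7–8, (III.5)–(III.7) pp.351–352] -/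
theorem a_pos_oneLoop (t : ℝ) : LemmaIII1PositivityPrinted (fun η => oneLoopA4Integral P η t) :=
  lemmaIII1Positivity_oneLoopA4Integral P t

/-- **Lemma III.1 AS PRINTED — both sentences — for the one-loop counterterm family**, for every gauge parameter `ζ > 0`
(`t = 1/ζ − 1`), every profile `τ`, every `η > 0`, every `M > 0`, every nowhere-vanishing `λ_ρ`, and every `c_ρ, d_ρ, e_ρ` of the
printed form: (1) file 3's `LemmaIII1ScalingPrinted (oneLoopFamily …) M` ((III.2)); (2) its limits `a`, `b` are
`oneLoopA4Integral P η (1/ζ − 1)` and `oneLoopA2Integral P η (1/ζ − 1)` (constant ratios); (3) file 3's `LemmaIII1PositivityPrinted`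
for `η ↦ a(η)` («η small enough … a is strictly positive», threshold uniform in `τ`); (4) `b < 0` («this A² counterterm is
positive»). NOT claimed: that this family is MRS's `CT_ρ` beyond one loop; the values of `c, d, e`.
[cite: MagnenRivasseauSeneor1993, §III Lemma III.1 (III.2) p.348 and tl.7–8; (III.4)–(III.7) pp.351–352; p.350 tl.36 – p.351 tl.4] -/
theorem lemmaIII1_oneLoop {ζ : ℝ} (hζ : 0 < ζ) {η : ℝ} (hη : 0 < η) (hM : 0 < M) (hlam : ∀ ρ, lamB ρ ≠ 0)
    (hc : ∃ c₀ : ℝ, Tendsto (fun ρ : ℕ => c ρ / lamB ρ ^ 2) atTop (𝓝 c₀))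
    (hd : ∃ d₀ : ℝ, Tendsto (fun ρ : ℕ => d ρ / lamB ρ ^ 2) atTop (𝓝 d₀))
    (he : ∃ e₀ : ℝ, Tendsto (fun ρ : ℕ => e ρ / lamB ρ ^ 4) atTop (𝓝 e₀)) :
    LemmaIII1ScalingPrinted (oneLoopFamily P η M (1 / ζ - 1) lamB c d e) M ∧
    (∀ ρ, (oneLoopFamily P η M (1 / ζ - 1) lamB c d e).a ρ / lamB ρ ^ 4 = oneLoopA4Integral P η (1 / ζ - 1)) ∧
    (∀ ρ, (oneLoopFamily P η M (1 / ζ - 1) lamB c d e).b ρ / (M ^ (2 * ρ) * lamB ρ ^ 2) = oneLoopA2Integral P η (1 / ζ - 1)) ∧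
    LemmaIII1PositivityPrinted (fun η' => oneLoopA4Integral P η' (1 / ζ - 1)) ∧
    oneLoopA2Integral P η (1 / ζ - 1) < 0 :=
  ⟨lemmaIII1Scaling_oneLoop P η (1 / ζ - 1) c d e hM hlam hc hd he,
    fun ρ => oneLoopFamily_a_div P η (1 / ζ - 1) c d e hM hlam ρ,
    fun ρ => oneLoopFamily_b_div P η (1 / ζ - 1) c d e hM hlam ρ,
    a_pos_oneLoop P (1 / ζ - 1),
    sign_b_oneLoop P hη (gaugeParam_t_ge hζ)⟩

end LemmaIII1OneLoop

end Literature.MathematicalPhysics.QuantumFieldTheory.MagnenRivasseauSeneor1993
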